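import Literature.MathematicalPhysics.QuantumFieldTheory.Balaban1983to89.Beta.HessKerDressedCauchy

/-!
# `Balaban1983to89.Beta.HessKerDressedLimit` — the wall's identification binder MADE EXPLICIT: constructed limit primitives from
# all-scales data, the classes are closed under them, and «the wall ⟺ `secondMoment (hessKer (Π K∞ Π) (V^Π_{K∞} S∞) W∞) = stepBal`»
# (asymptotic lane asym1, gen 13, v1; LIMIT-CURRENCY twin of `HessKerDressedCauchy`, bookkeeping only)

HONEST FRAMING (cell contract, verbatim): «discharging `BetaPertH` makes Bałaban's UV stability UNCONDITIONAL — a real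
constructive-QFT result; it is NOT the continuum limit and NOT the Clay problem.»  THIS MODULE is [folklore] real analysis on `ℤ^D`
(completeness of `ℝ` entry by entry, `le_of_tendsto`, the tree's Lipschitz lemmas applied between a finite level and a limit object); it
formalises NO statement printed in Bałaban's papers, cites none as a hypothesis, mints no `Prop` fact, instantiates NO binder of the wall at a
value (RULING (R18-3); referee W-R556: the colour weights `cE, cVH, cΛ`, the tables `W j` and their localisation data stay UNIVERSALLY BOUND,
no `UNITS` numeral is touched — v1.2 of `BalabanStepJetsSucc` included) and DISCHARGES NOTHING of it.  NOT summit progress.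

ABSOLUTE RULE (cell, verbatim): «No internally-minted statement may enter as a cited fact. Every hypothesis is either
kernel-proved in this package or a verbatim quotation of a PUBLISHED theorem with page reference. The manuscript(s) under
audit are NOT citable for their own disputed steps — they are the thing under adjudication; programme-internal
(2001/route/tribunal) claims are never citable.»  Every theorem below is kernel-proved from explicit, abstract hypotheses on
matrix-fibred kernels; the data binders ((CONV-C-Cauchy): `j`-uniform pointwise bounds + all-scales deviations with a rate; or their
limit-currency form: bounds + deviations from a NAMED limit object) are HYPOTHESIS SHAPES with free constants, never asserted, and nothing
here says that Bałaban's objects satisfy them (located, NOT in print: O-asym1-1 / O-an2-2).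

WHY THIS LEAF.  The lead's BINDER CHECK of `HessKerDressedCauchy` (WALL v2.18, road A2) lists, beyond the six (CONV-C-Cauchy) data binders,
ONE analytic binder: `hident : secondMoment (limKernelOf (TbalOf Lc (JsBalOf …))) μ ν = B12Normalization.stepBal N Lc` — an identity about
the TELESCOPED entrywise limit (`LimitRate.limKernelOf`) of a family of COMPOSITE kernels.  Whoever is to prove it (the level-0 / limit
computation) needs the left-hand side as an explicit object.  This leaf supplies it: under the same six binders the three PRIMITIVE families —
the decimated composite resolvents `KInvStep Lc j`, the undressed stencils `(JsBal0Of … j).S`, the tables `W j` — converge ENTRYWISE to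
constructed limits `K∞ := limMKerOf (KInvStep Lc)`, `S∞ := limStOf (j ↦ (JsBal0Of … j).S)`, `W∞ := limTabOf W` which lie in the SAME classes
with the SAME constants (the classes `Decays` / `BiLoc` / `LocStencil` / `VertexFamily₂` are pointwise inequalities, hence closed under entrywise
limits), the telescoped limit kernel IS — entry by entry in the `(μ,ν)` component — the resolvent Hessian kernel of the DRESSED limit primitives,
and therefore THE WALL ⟺ `secondMoment (hessKer (axDressK Lc K∞) (axVertexOfK K∞ Lc S∞) W∞) μ ν = stepBal N Lc`.  The same equivalence holds
for ANY limit triple `(K∞, S∞, W∞)` a supplier may name together with rate data (e.g. a decimated continuum resolvent): by uniqueness of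
entrywise limits it is then the constructed one (`limMKerOf_eq_of_decays_rate`).

CONTENT (all [folklore]; three `def`s of OBJECTS — `limMKerOf`, `limStOf`, `limTabOf`, entrywise `RateCertificate.CauchyRate.lim` — and NO
`Prop`; every constant explicit).
* §1 ENTRYWISE CONSTRUCTED LIMITS, generic `MKer D F`: `limMKerOf K x y a b := CauchyRate.lim (j ↦ K j x y a b)`; the scalar brick
  `allScalesSeq_of_weighted` (`|t (k+j) − t k| ≤ c θ^k w` is asym2's `AllScalesSeq t (c·w) θ`); CLOSURE: all-scales data with `θ < 1` in
  `Decays` (`decays_limMKerOf`: the uniform bound passes to the limit; `decays_sub_limMKerOf`: `Decays (K k − limMKerOf K) (c θ^k) δ`, SAME `c` —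
  `AllScalesSeq.geomRate`, no `1/(1−θ)`), in `BiLoc` (`biLoc_limMKerOf`, `biLoc_sub_limMKerOf`), hence in an1's `LocStencil` (`locStencil_limStOf`,
  `locStencil_sub_limStOf`) and `VertexFamily₂` (`vertexFamily₂_limTabOf`, `vertexFamily₂_sub_limTabOf`); entrywise convergence
  (`tendsto_limMKerOf_of_decays`, `tendsto_of_decays_rate`, `tendsto_of_biLoc_rate`); UNIQUENESS (`limMKerOf_eq_of_tendsto`,
  `limMKerOf_eq_of_decays_rate`, `limMKerOf_eq_of_biLoc_rate`, `limStOf_eq_of_rate`, `limTabOf_eq_of_rate`: a NAMED limit with rate data IS the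
  constructed one); and the converse CURRENCY EXCHANGE (`abs_sub_le_two_mul_of_rate`: deviations `c θ^k w` from a limit ⟹ all-scales deviations
  `2c θ^k w`, `0 ≤ θ ≤ 1`; `decays_allScales_of_rate`, `biLoc_allScales_of_rate`, `locStencil_allScales_of_rate`, `vertexFamily₂_allScales_of_rate`)
  — so (CONV-C-Cauchy) and its limit-currency form are interchangeable supplier targets (Cauchy ⟹ limit: same constant; limit ⟹ Cauchy: factor `2`).
* §2 GENERIC `d`, dressing level `N ≥ 1`, ANY limit primitives `(K∞, S∞, W∞)` in the classes with rate data from the families: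
  `geometricRate_hessKer_dress_of_pointwise_lim` — `LimitRate.GeometricRate (k ↦ hessKer (Π K_k Π) (V^Π_{K_k} S_k) W_k) (hessKer (Π K∞ Π) (V^Π_{K∞} S∞) W∞)
  μ ν (lipW …) (R·N) θ` with the SAME explicit 8-slot `HessKerSchur.lipW` constant as `HessKerDressedCauchy.allScalesRate_hessKer_dress_of_pointwise`
  (the tree's `HessKerSchur.geometricRate_hessKer_halfV` + `vertexFamilyW_vertexOfK_rate` at `(K, Πᵀ S)`, the dressing's additivity
  `HessKerDressedCauchy.axDressK_sub` / `coProj_sub` and an2's `AxialDressing.vertexOfK_coProj_eq`); `geomRate_secondMoment_hessKer_dress_of_pointwise_lim`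
  (`RateCertificate.GeomRate` of the second moments TO `secondMoment (hessKer (Π K∞ Π) (V^Π_{K∞} S∞) W∞) μ ν`, `c₀ = betaPrime510 (d+1) (lipW …) (R·N)`);
  `limKernelOf_hessKer_dress_apply` (the telescoped limit kernel of the dressed family IS that Hessian kernel, entrywise; `0 ≤ θ < 1`);
  `secondMoment_congr`.
* §3 `d = 3`, THE WALL'S FAMILY `TbalOf Lc (JsBalOf hLc cE cVH cΛ W Cw δw hδw hW)` (an2's `TbalOf_JsBalOf` BY NAME):
  LIMIT CURRENCY — `geomRate_secondMoment_TbalOf_JsBalOf_lim`, **`d1Drift_JsBalOf_iff_of_lim`** (`D1Drift Lc (JsBalOf …) N μ ν ↔ secondMoment (hessKer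
  (axDressK Lc K∞) (axVertexOfK K∞ Lc S∞) W∞) μ ν = stepBal N Lc` for ANY named limits with rate data, `0 ≤ θ < 1`), `d1Drift_JsBalOf_of_lim_eq`;
  CAUCHY CURRENCY (EXACTLY the six binders of `HessKerDressedCauchy` §4, nothing added) — **`d1Drift_JsBalOf_iff_of_cauchy`** (the same
  equivalence at the CONSTRUCTED limits), `d1Drift_JsBalOf_of_cauchy_eq`, and the DICTIONARY with road A2's `b_∞`:
  `limKernelOf_TbalOf_JsBalOf_apply` (`limKernelOf (TbalOf Lc (JsBalOf …)) μ ν x = hessKer (axDressK Lc K∞) (axVertexOfK K∞ Lc S∞) W∞ μ ν x`),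
  `secondMoment_limKernelOf_TbalOf_JsBalOf` — i.e. the lead's `hident` and the explicit identity are THE SAME statement under the data.

UPSHOT FOR THE WALL.  BINDER LIST for road A2 unchanged ({(CONV-C-Cauchy) ; `hident`}); what changes is the READING of `hident`: it is the
identity `secondMoment (hessKer (axDressK Lc K∞) (axVertexOfK K∞ Lc S∞) W∞) μ ν = stepBal N Lc` for three explicit limit objects — the
entrywise limits of the decimated composite resolvents, of the undressed stencils and of the tables — or, equivalently, for any limit triple
the supplier characterises with rate data.  NOTHING of it is proved here.

RELATION TO THE TREE (no duplication): `HessKerDressedCauchy` (additivity of the dressing, (UD) of the dressed family, the all-scales END, the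
sequence lemma `d1Drift_iff_lim_eq`), `HessKerSchur` (weighted classes, `geometricRate_hessKer_halfV`, `vertexFamilyW_vertexOfK[_rate]`),
`LimitRate` (`limKernelOf`, `GeometricRate.limKernelOf_eq`, `abs_secondMoment_sub_limit_le`), asym2's `RemainderConstAllScales` (`AllScalesSeq`,
`allScalesSeq_of_geomRate`) and `RateCertificate` (`CauchyRate.lim`, `GeomRate.tendsto`), an2's `AxialDressing` / `BalabanStepJetsSucc` are
USED BY NAME; nothing is re-proved.  New here: the entrywise limit objects and the closure / uniqueness / exchange lemmas of §1, the
limit-currency END of the dressed family, and the explicit form of the identification binder.  DOWNSTREAM (not imported): strat-b14's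
`AveragedAFCarrierJsBalCauchy` consumes `HessKerDressedCauchy` by name; this leaf only ADDS theorems (no v1 declaration of the parent is
touched).

WHAT IS NOT HERE (located, NOT in print, NOT claimed): any data hypothesis for Bałaban's primitives (supplier rows an2 / an5 / t4-ne2;
Bałaban's papers print `η`-UNIFORM bounds, not scale-to-scale rates); the identification itself (road A2 second half / road (1): an3's level-0
and limit computation, the lead); any numeric value of `C, c_•, δ_•, θ, R`; `betaPertH_holds`.  NOT continuum, NOT Clay.
-/

open Finset Filter Topology
open scoped BigOperators
open Literature.MathematicalPhysics.QuantumFieldTheory.Balaban1983to89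
open Literature.MathematicalPhysics.QuantumFieldTheory.Balaban1983to89.Beta
open B12Sec2to5 (l1 l1_nonneg Decay510 betaPrime510)
open ExpKernelCalculus (MKer Decays BiLoc VertexFamily₂ hessKer Zl)
open LimitRate (limKernelOf)
open HessKerSchur (ColW VertexFamilyW VertexFamily₂W hessW lipW LocStencilW colW_of_decays locStencilW_of_locStencil
  vertexFamily₂W_of_vertexFamily₂ geometricRate_hessKer_halfV vertexFamilyW_vertexOfK vertexFamilyW_vertexOfK_rate)
open RemainderConstAllScales (AllScalesSeq allScalesSeq_of_geomRate)
open RateCertificate (GeomRate CauchyRate)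
open OneStepResolventKernel (Fib LocStencil JetData)
open OneStepKernelFamily (vertexOfK KInvStep TbalOf D1Drift)
open AxialDressing (axDressK cAx cN' decays_axDressK locStencil_coProj axVertexOfK vertexOfK_coProj_eq)
open AxialProjector (coProj)
open BalabanStepJetsSucc (JsBal0Of JsBalOf TbalOf_JsBalOf)
open HessKerDressedCauchy (decays_axDressK_sub locStencil_coProj_sub axVertexOfK_eq_vertexOfK_coProj
  uniformDecay_hessKer_dress_of_pointwise d1Drift_iff_lim_eq one_le_Lc)

namespace Literature.MathematicalPhysics.QuantumFieldTheory.Balaban1983to89.Beta.HessKerDressedLimit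

/-! ## §1 Entrywise constructed limits of kernel families; the classes are closed under them; uniqueness; currency exchange -/

section Scalar

/-- [folklore] A weighted all-scales bound on one real sequence, `|t (k+j) − t k| ≤ c θ^k w`, is asym2's `AllScalesSeq t (c·w) θ`. -/
theorem allScalesSeq_of_weighted {t : ℕ → ℝ} {c w θ : ℝ} (h : ∀ k j, |t (k + j) - t k| ≤ c * θ ^ k * w) :
    AllScalesSeq t (c * w) θ := fun k j => (h k j).trans_eq (by ring)

/-- [folklore] … hence, for `θ < 1`, the sequence converges to its constructed limit `CauchyRate.lim t` (completeness of `ℝ`). -/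
theorem tendsto_lim_of_weighted {t : ℕ → ℝ} {c w θ : ℝ} (h : ∀ k j, |t (k + j) - t k| ≤ c * θ ^ k * w) (hθ1 : θ < 1) :
    Tendsto t atTop (𝓝 (CauchyRate.lim t)) :=
  (allScalesSeq_of_weighted h).tendsto_lim hθ1

/-- [folklore] … with the two-ended rate about the limit at the SAME constant: `|t k − lim t| ≤ c θ^k w` (let `j → ∞`; no `1/(1−θ)`). -/
theorem abs_sub_lim_le_of_weighted {t : ℕ → ℝ} {c w θ : ℝ} (h : ∀ k j, |t (k + j) - t k| ≤ c * θ ^ k * w) (hθ1 : θ < 1) (k : ℕ) :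
    |t k - CauchyRate.lim t| ≤ c * θ ^ k * w :=
  (((allScalesSeq_of_weighted h).geomRate hθ1) k).trans_eq (by ring)

/-- [folklore] … and a uniform weighted bound `|t j| ≤ C w′` passes to the limit (`le_of_tendsto'`). -/
theorem abs_lim_le_of_weighted {t : ℕ → ℝ} {c w θ C w' : ℝ} (h : ∀ k j, |t (k + j) - t k| ≤ c * θ ^ k * w) (hθ1 : θ < 1)
    (hbd : ∀ j, |t j| ≤ C * w') : |CauchyRate.lim t| ≤ C * w' :=
  le_of_tendsto' (tendsto_lim_of_weighted h hθ1).abs hbd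

/-- [folklore] CURRENCY EXCHANGE, scalar form: deviations `≤ c θ^k w` from SOME value `a` (`0 ≤ c`, `0 ≤ w`, `0 ≤ θ ≤ 1`) give all-scales
deviations `≤ 2c θ^k w` (triangle inequality through `a`, `θ^{k+j} ≤ θ^k`). -/
theorem abs_sub_le_two_mul_of_rate {t : ℕ → ℝ} {a c w θ : ℝ} (h : ∀ k, |t k - a| ≤ c * θ ^ k * w) (hc : 0 ≤ c) (hw : 0 ≤ w)
    (hθ0 : 0 ≤ θ) (hθ1 : θ ≤ 1) (k j : ℕ) : |t (k + j) - t k| ≤ 2 * c * θ ^ k * w := by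
  have hpow : θ ^ (k + j) ≤ θ ^ k := by
    rw [pow_add]; exact mul_le_of_le_one_right (pow_nonneg hθ0 k) (pow_le_one₀ hθ0 hθ1)
  have h1 : |t (k + j) - a| ≤ c * θ ^ k * w :=
    (h (k + j)).trans (mul_le_mul_of_nonneg_right (mul_le_mul_of_nonneg_left hpow hc) hw)
  calc |t (k + j) - t k| = |(t (k + j) - a) - (t k - a)| := by rw [sub_sub_sub_cancel_right]
    _ ≤ |t (k + j) - a| + |t k - a| := abs_sub _ _
    _ ≤ c * θ ^ k * w + c * θ ^ k * w := add_le_add h1 (h k)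
    _ = 2 * c * θ ^ k * w := by ring

end Scalar

section Lim

variable {D : ℕ} {F : Type*}

/-- [folklore] **THE ENTRYWISE CONSTRUCTED LIMIT** of a family of matrix-fibred kernels: `(limMKerOf K) x y a b := lim_j K_j x y a b`
(`RateCertificate.CauchyRate.lim = limUnder atTop`: a definite real number for every entry, THE limit whenever the entry converges).  An
OBJECT, not a hypothesis. -/
noncomputable def limMKerOf (K : ℕ → MKer D F) : MKer D F := fun x y a b => CauchyRate.lim fun j => K j x y a b

/-- [folklore] Entrywise constructed limit of a family of STENCIL-type tables `S j i u : MKer D F`. -/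
noncomputable def limStOf {ι κ : Type*} (S : ℕ → ι → κ → MKer D F) : ι → κ → MKer D F :=
  fun i u => limMKerOf fun j => S j i u

/-- [folklore] Entrywise constructed limit of a family of SECOND-ORDER tables `W j μ y ν y′ : MKer D F`. -/
noncomputable def limTabOf {ι₁ κ₁ ι₂ κ₂ : Type*} (W : ℕ → ι₁ → κ₁ → ι₂ → κ₂ → MKer D F) : ι₁ → κ₁ → ι₂ → κ₂ → MKer D F :=
  fun μ y ν y' => limMKerOf fun j => W j μ y ν y'

/-- [folklore] Unfolding lemma. -/
theorem limMKerOf_apply (K : ℕ → MKer D F) (x y : Fin D → ℤ) (a b : F) :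
    limMKerOf K x y a b = CauchyRate.lim (fun j => K j x y a b) := rfl

/-- [folklore] Unfolding lemma. -/
theorem limStOf_apply {ι κ : Type*} (S : ℕ → ι → κ → MKer D F) (i : ι) (u : κ) :
    limStOf S i u = limMKerOf (fun j => S j i u) := rfl

/-- [folklore] Unfolding lemma. -/
theorem limTabOf_apply {ι₁ κ₁ ι₂ κ₂ : Type*} (W : ℕ → ι₁ → κ₁ → ι₂ → κ₂ → MKer D F) (μ : ι₁) (y : κ₁) (ν : ι₂) (y' : κ₂) :
    limTabOf W μ y ν y' = limMKerOf (fun j => W j μ y ν y') := rfl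

/-- [folklore] Entries of a difference of matrix-fibred kernels. -/
theorem mker_sub_apply (A B : MKer D F) (x y : Fin D → ℤ) (a b : F) : (A - B) x y a b = A x y a b - B x y a b := rfl

/-! ### `Decays` -/

/-- [folklore] Under all-scales `Decays` deviations with `θ < 1` every entry converges to the constructed limit. -/
theorem tendsto_limMKerOf_of_decays {K : ℕ → MKer D F} {c δ θ : ℝ} (hKall : ∀ k j, Decays (K (k + j) - K k) (c * θ ^ k) δ)
    (hθ1 : θ < 1) (x y : Fin D → ℤ) (a b : F) : Tendsto (fun j => K j x y a b) atTop (𝓝 (limMKerOf K x y a b)) :=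
  tendsto_lim_of_weighted (fun k j => by simpa only [mker_sub_apply] using hKall k j x y a b) hθ1

/-- [folklore] **CLOSURE OF `Decays`**: a `j`-uniform bound `Decays (K j) C δ′` passes to the constructed limit, SAME constant and rate. -/
theorem decays_limMKerOf {K : ℕ → MKer D F} {C c δ δ' θ : ℝ} (hK : ∀ j, Decays (K j) C δ')
    (hKall : ∀ k j, Decays (K (k + j) - K k) (c * θ ^ k) δ) (hθ1 : θ < 1) : Decays (limMKerOf K) C δ' := fun x y a b =>
  abs_lim_le_of_weighted (fun k j => by simpa only [mker_sub_apply] using hKall k j x y a b) hθ1 fun j => hK j x y a b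

/-- [folklore] **RATE TO THE CONSTRUCTED LIMIT, SAME CONSTANT**: `Decays (K k − limMKerOf K) (c θ^k) δ` for every `k` (no `1/(1−θ)`). -/
theorem decays_sub_limMKerOf {K : ℕ → MKer D F} {c δ θ : ℝ} (hKall : ∀ k j, Decays (K (k + j) - K k) (c * θ ^ k) δ)
    (hθ1 : θ < 1) (k : ℕ) : Decays (K k - limMKerOf K) (c * θ ^ k) δ := fun x y a b => by
  rw [mker_sub_apply, limMKerOf_apply]
  exact abs_sub_lim_le_of_weighted (t := fun j => K j x y a b) (fun k j => by simpa only [mker_sub_apply] using hKall k j x y a b) hθ1 k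

/-- [folklore] Entrywise convergence to a NAMED limit from `Decays`-rate data (`0 ≤ θ < 1`). -/
theorem tendsto_of_decays_rate {K : ℕ → MKer D F} {Kinf : MKer D F} {c δ θ : ℝ} (h : ∀ k, Decays (K k - Kinf) (c * θ ^ k) δ)
    (hθ0 : 0 ≤ θ) (hθ1 : θ < 1) (x y : Fin D → ℤ) (a b : F) : Tendsto (fun j => K j x y a b) atTop (𝓝 (Kinf x y a b)) :=
  LimitRate.tendsto_of_abs_sub_le_geometric (c₀ := c * Real.exp (-δ * l1 (x - y))) hθ0 hθ1 fun k => by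
    simpa only [mker_sub_apply, mul_right_comm] using h k x y a b

/-- [folklore] **UNIQUENESS**: a kernel to which the family converges entrywise IS the constructed limit. -/
theorem limMKerOf_eq_of_tendsto {K : ℕ → MKer D F} {Kinf : MKer D F}
    (h : ∀ x y a b, Tendsto (fun j => K j x y a b) atTop (𝓝 (Kinf x y a b))) : limMKerOf K = Kinf :=
  funext fun x => funext fun y => funext fun a => funext fun b => (h x y a b).limUnder_eq

/-- [folklore] … in particular any NAMED limit with `Decays`-rate data (`0 ≤ θ < 1`) is the constructed one. -/
theorem limMKerOf_eq_of_decays_rate {K : ℕ → MKer D F} {Kinf : MKer D F} {c δ θ : ℝ}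
    (h : ∀ k, Decays (K k - Kinf) (c * θ ^ k) δ) (hθ0 : 0 ≤ θ) (hθ1 : θ < 1) : limMKerOf K = Kinf :=
  limMKerOf_eq_of_tendsto (tendsto_of_decays_rate h hθ0 hθ1)

/-- [folklore] CURRENCY EXCHANGE in `Decays`: rate data to a named limit (`0 ≤ θ ≤ 1`) ⟹ all-scales deviations with constant `2c`. -/
theorem decays_allScales_of_rate {K : ℕ → MKer D F} {Kinf : MKer D F} {c δ θ : ℝ} (h : ∀ k, Decays (K k - Kinf) (c * θ ^ k) δ)
    (hθ0 : 0 ≤ θ) (hθ1 : θ ≤ 1) (k j : ℕ) : Decays (K (k + j) - K k) (2 * c * θ ^ k) δ := fun x y a b => by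
  have hc : 0 ≤ c := by simpa using (h 0).nonneg a
  rw [mker_sub_apply]
  exact abs_sub_le_two_mul_of_rate (t := fun j => K j x y a b) (fun k => by simpa only [mker_sub_apply] using h k x y a b) hc
    (Real.exp_pos _).le hθ0 hθ1 k j

/-! ### `BiLoc` -/

/-- [folklore] **CLOSURE OF `BiLoc`**: a `j`-uniform bi-localisation bound passes to the constructed limit, SAME constant and rate. -/
theorem biLoc_limMKerOf {T : ℕ → MKer D F} {p q : Fin D → ℤ} {C c δ δ' θ : ℝ} (hT : ∀ j, BiLoc (T j) p q C δ')
    (hall : ∀ k j, BiLoc (T (k + j) - T k) p q (c * θ ^ k) δ) (hθ1 : θ < 1) : BiLoc (limMKerOf T) p q C δ' := fun x y a b =>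
  abs_lim_le_of_weighted (fun k j => by simpa only [mker_sub_apply] using hall k j x y a b) hθ1 fun j => hT j x y a b

/-- [folklore] Rate to the constructed limit in `BiLoc`, SAME constant. -/
theorem biLoc_sub_limMKerOf {T : ℕ → MKer D F} {p q : Fin D → ℤ} {c δ θ : ℝ}
    (hall : ∀ k j, BiLoc (T (k + j) - T k) p q (c * θ ^ k) δ) (hθ1 : θ < 1) (k : ℕ) :
    BiLoc (T k - limMKerOf T) p q (c * θ ^ k) δ := fun x y a b => by
  rw [mker_sub_apply, limMKerOf_apply]
  exact abs_sub_lim_le_of_weighted (t := fun j => T j x y a b) (fun k j => by simpa only [mker_sub_apply] using hall k j x y a b) hθ1 k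

/-- [folklore] Entrywise convergence to a NAMED limit from `BiLoc`-rate data (`0 ≤ θ < 1`). -/
theorem tendsto_of_biLoc_rate {T : ℕ → MKer D F} {Tinf : MKer D F} {p q : Fin D → ℤ} {c δ θ : ℝ}
    (h : ∀ k, BiLoc (T k - Tinf) p q (c * θ ^ k) δ) (hθ0 : 0 ≤ θ) (hθ1 : θ < 1) (x y : Fin D → ℤ) (a b : F) :
    Tendsto (fun j => T j x y a b) atTop (𝓝 (Tinf x y a b)) :=
  LimitRate.tendsto_of_abs_sub_le_geometric (c₀ := c * Real.exp (-δ * (l1 (x - p) + l1 (y - q)))) hθ0 hθ1 fun k => by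
    simpa only [mker_sub_apply, mul_right_comm] using h k x y a b

/-- [folklore] … so a NAMED limit with `BiLoc`-rate data is the constructed one. -/
theorem limMKerOf_eq_of_biLoc_rate {T : ℕ → MKer D F} {Tinf : MKer D F} {p q : Fin D → ℤ} {c δ θ : ℝ}
    (h : ∀ k, BiLoc (T k - Tinf) p q (c * θ ^ k) δ) (hθ0 : 0 ≤ θ) (hθ1 : θ < 1) : limMKerOf T = Tinf :=
  limMKerOf_eq_of_tendsto (tendsto_of_biLoc_rate h hθ0 hθ1)

/-- [folklore] CURRENCY EXCHANGE in `BiLoc` (needs an inhabited fibre to read `0 ≤ c` off the data). -/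
theorem biLoc_allScales_of_rate {T : ℕ → MKer D F} {Tinf : MKer D F} {p q : Fin D → ℤ} {c δ θ : ℝ}
    (h : ∀ k, BiLoc (T k - Tinf) p q (c * θ ^ k) δ) (hθ0 : 0 ≤ θ) (hθ1 : θ ≤ 1) (k j : ℕ) :
    BiLoc (T (k + j) - T k) p q (2 * c * θ ^ k) δ := fun x y a b => by
  have hc : 0 ≤ c := by simpa using (h 0).nonneg a
  rw [mker_sub_apply]
  exact abs_sub_le_two_mul_of_rate (t := fun j => T j x y a b) (fun k => by simpa only [mker_sub_apply] using h k x y a b) hc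
    (Real.exp_pos _).le hθ0 hθ1 k j

/-! ### `VertexFamily₂` (generic `D`) -/

/-- [folklore] **CLOSURE OF `VertexFamily₂`** under entrywise limits of the tables. -/
theorem vertexFamily₂_limTabOf {W : ℕ → Fin D → (Fin D → ℤ) → Fin D → (Fin D → ℤ) → MKer D F} {N : ℕ} {Cw c δ δ' θ : ℝ}
    (hW : ∀ j, VertexFamily₂ (W j) N Cw δ') (hWall : ∀ k j, VertexFamily₂ (W (k + j) - W k) N (c * θ ^ k) δ) (hθ1 : θ < 1) :
    VertexFamily₂ (limTabOf W) N Cw δ' := fun μ y ν y' =>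
  biLoc_limMKerOf (T := fun j => W j μ y ν y') (fun j => hW j μ y ν y')
    (fun k j => by simpa only [Pi.sub_apply] using hWall k j μ y ν y') hθ1

/-- [folklore] Rate to the constructed limit tables, SAME constant. -/
theorem vertexFamily₂_sub_limTabOf {W : ℕ → Fin D → (Fin D → ℤ) → Fin D → (Fin D → ℤ) → MKer D F} {N : ℕ} {c δ θ : ℝ}
    (hWall : ∀ k j, VertexFamily₂ (W (k + j) - W k) N (c * θ ^ k) δ) (hθ1 : θ < 1) (k : ℕ) :
    VertexFamily₂ (W k - limTabOf W) N (c * θ ^ k) δ := fun μ y ν y' => by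
  simpa only [Pi.sub_apply, limTabOf_apply] using
    biLoc_sub_limMKerOf (T := fun j => W j μ y ν y') (fun k j => by simpa only [Pi.sub_apply] using hWall k j μ y ν y') hθ1 k

/-- [folklore] A NAMED limit table with rate data is the constructed one. -/
theorem limTabOf_eq_of_rate {W : ℕ → Fin D → (Fin D → ℤ) → Fin D → (Fin D → ℤ) → MKer D F}
    {Winf : Fin D → (Fin D → ℤ) → Fin D → (Fin D → ℤ) → MKer D F} {N : ℕ} {c δ θ : ℝ}
    (h : ∀ k, VertexFamily₂ (W k - Winf) N (c * θ ^ k) δ) (hθ0 : 0 ≤ θ) (hθ1 : θ < 1) : limTabOf W = Winf :=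
  funext fun μ => funext fun y => funext fun ν => funext fun y' =>
    limMKerOf_eq_of_biLoc_rate (T := fun j => W j μ y ν y') (fun k => by simpa only [Pi.sub_apply] using h k μ y ν y') hθ0 hθ1

/-- [folklore] CURRENCY EXCHANGE in `VertexFamily₂`. -/
theorem vertexFamily₂_allScales_of_rate {W : ℕ → Fin D → (Fin D → ℤ) → Fin D → (Fin D → ℤ) → MKer D F}
    {Winf : Fin D → (Fin D → ℤ) → Fin D → (Fin D → ℤ) → MKer D F} {N : ℕ} {c δ θ : ℝ}
    (h : ∀ k, VertexFamily₂ (W k - Winf) N (c * θ ^ k) δ) (hθ0 : 0 ≤ θ) (hθ1 : θ ≤ 1) (k j : ℕ) :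
    VertexFamily₂ (W (k + j) - W k) N (2 * c * θ ^ k) δ := fun μ y ν y' => by
  simpa only [Pi.sub_apply] using biLoc_allScales_of_rate (T := fun j => W j μ y ν y')
    (fun k => by simpa only [Pi.sub_apply] using h k μ y ν y') hθ0 hθ1 k j

end Lim

/-! ### `LocStencil` (an1's stencil class, `MKer (d+1) (Fib d)`) -/

section Stencil

variable {d : ℕ}

/-- [folklore] **CLOSURE OF `LocStencil`** under entrywise limits of the stencils. -/
theorem locStencil_limStOf {S : ℕ → Fin (d + 1) → (Fin (d + 1) → ℤ) → MKer (d + 1) (Fib d)} {Cs c δ δ' θ : ℝ}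
    (hS : ∀ j, LocStencil (S j) Cs δ') (hSall : ∀ k j, LocStencil (S (k + j) - S k) (c * θ ^ k) δ) (hθ1 : θ < 1) :
    LocStencil (limStOf S) Cs δ' := fun κ' u =>
  biLoc_limMKerOf (T := fun j => S j κ' u) (fun j => hS j κ' u) (fun k j => by simpa only [Pi.sub_apply] using hSall k j κ' u) hθ1

/-- [folklore] Rate to the constructed limit stencils, SAME constant. -/
theorem locStencil_sub_limStOf {S : ℕ → Fin (d + 1) → (Fin (d + 1) → ℤ) → MKer (d + 1) (Fib d)} {c δ θ : ℝ}
    (hSall : ∀ k j, LocStencil (S (k + j) - S k) (c * θ ^ k) δ) (hθ1 : θ < 1) (k : ℕ) :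
    LocStencil (S k - limStOf S) (c * θ ^ k) δ := fun κ' u => by
  simpa only [Pi.sub_apply, limStOf_apply] using
    biLoc_sub_limMKerOf (T := fun j => S j κ' u) (fun k j => by simpa only [Pi.sub_apply] using hSall k j κ' u) hθ1 k

/-- [folklore] A NAMED limit stencil family with rate data is the constructed one. -/
theorem limStOf_eq_of_rate {S : ℕ → Fin (d + 1) → (Fin (d + 1) → ℤ) → MKer (d + 1) (Fib d)}
    {Sinf : Fin (d + 1) → (Fin (d + 1) → ℤ) → MKer (d + 1) (Fib d)} {c δ θ : ℝ}
    (h : ∀ k, LocStencil (S k - Sinf) (c * θ ^ k) δ) (hθ0 : 0 ≤ θ) (hθ1 : θ < 1) : limStOf S = Sinf :=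
  funext fun κ' => funext fun u =>
    limMKerOf_eq_of_biLoc_rate (T := fun j => S j κ' u) (fun k => by simpa only [Pi.sub_apply] using h k κ' u) hθ0 hθ1

/-- [folklore] CURRENCY EXCHANGE in `LocStencil`. -/
theorem locStencil_allScales_of_rate {S : ℕ → Fin (d + 1) → (Fin (d + 1) → ℤ) → MKer (d + 1) (Fib d)}
    {Sinf : Fin (d + 1) → (Fin (d + 1) → ℤ) → MKer (d + 1) (Fib d)} {c δ θ : ℝ}
    (h : ∀ k, LocStencil (S k - Sinf) (c * θ ^ k) δ) (hθ0 : 0 ≤ θ) (hθ1 : θ ≤ 1) (k j : ℕ) :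
    LocStencil (S (k + j) - S k) (2 * c * θ ^ k) δ := fun κ' u => by
  simpa only [Pi.sub_apply] using biLoc_allScales_of_rate (T := fun j => S j κ' u)
    (fun k => by simpa only [Pi.sub_apply] using h k κ' u) hθ0 hθ1 k j

end Stencil

/-! ## §2 Generic `d`: the dressed family against ANY limit primitives in the classes — `GeometricRate`, `GeomRate`, the limit kernel -/

section DressedLim

variable {d : ℕ}
variable {K : ℕ → MKer (d + 1) (Fib d)} {Kinf : MKer (d + 1) (Fib d)}
  {S : ℕ → Fin (d + 1) → (Fin (d + 1) → ℤ) → MKer (d + 1) (Fib d)} {Sinf : Fin (d + 1) → (Fin (d + 1) → ℤ) → MKer (d + 1) (Fib d)}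
  {W : ℕ → Fin (d + 1) → (Fin (d + 1) → ℤ) → Fin (d + 1) → (Fin (d + 1) → ℤ) → MKer (d + 1) (Fib d)}
  {Winf : Fin (d + 1) → (Fin (d + 1) → ℤ) → Fin (d + 1) → (Fin (d + 1) → ℤ) → MKer (d + 1) (Fib d)}
  {R C cK δK Cs cS δS Cw cW δW θ : ℝ} {N : ℕ}

/-- [folklore] Second moments of kernels agreeing entrywise in the `(μ,ν)` component agree. -/
theorem secondMoment_congr {D : ℕ} {P Q : B12Beta.Kernel D} {μ ν : Fin D} (h : ∀ x, P μ ν x = Q μ ν x) :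
    B12Beta.secondMoment P μ ν = B12Beta.secondMoment Q μ ν := by
  unfold B12Beta.secondMoment
  exact tsum_congr fun x => by rw [h x]

/-- [folklore] **(PR) OF THE DRESSED FAMILY AGAINST NAMED LIMIT PRIMITIVES** `(K∞, S∞, W∞)`: `j`-uniform pointwise bounds on the
UNDRESSED primitives, the SAME bounds on the limits, and deviations `Decays (K k − K∞) (c_K θ^k) δK`, `LocStencil (S k − S∞) (c_S θ^k) δS`,
`VertexFamily₂ (W k − W∞) N (c_W θ^k) δW`, at any `0 < R < δK`, `R/2 < δS`, `R < δW` ⟹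
`GeometricRate (k ↦ hessKer (Π K_k Π) (V^Π_{K_k} S_k) W_k) (hessKer (Π K∞ Π) (V^Π_{K∞} S∞) W∞) μ ν (lipW …) (R·N) θ` with the SAME explicit
8-slot constant as `HessKerDressedCauchy.allScalesRate_hessKer_dress_of_pointwise`.  Both the family and the limit are rewritten through
`AxialDressing.vertexOfK_coProj_eq` (`V^Π_K S = vertexOfK K N (Πᵀ S)`); then `HessKerSchur.geometricRate_hessKer_halfV` with
`vertexFamilyW_vertexOfK_rate` at `(K, Πᵀ S)`; the deviations pass through the dressing by additivity.  NO range of `θ`. -/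
theorem geometricRate_hessKer_dress_of_pointwise_lim (hN : 1 ≤ N)
    (hK : ∀ k, Decays (K k) C δK) (hKinf : Decays Kinf C δK) (hKrate : ∀ k, Decays (K k - Kinf) (cK * θ ^ k) δK)
    (hS : ∀ k, LocStencil (S k) Cs δS) (hSinf : LocStencil Sinf Cs δS) (hSrate : ∀ k, LocStencil (S k - Sinf) (cS * θ ^ k) δS)
    (hW : ∀ k, VertexFamily₂ (W k) N Cw δW) (hWinf : VertexFamily₂ Winf N Cw δW)
    (hWrate : ∀ k, VertexFamily₂ (W k - Winf) N (cW * θ ^ k) δW)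
    (hR : 0 < R) (hRK : R < δK) (hRS : R / 2 < δS) (hRW : R < δW) (μ ν : Fin (d + 1)) :
    LimitRate.GeometricRate (fun k => hessKer (axDressK N (K k)) (axVertexOfK (K k) N (S k)) (W k))
      (hessKer (axDressK N Kinf) (axVertexOfK Kinf N Sinf) Winf) μ ν
      (lipW ((Fintype.card (Fib d) : ℝ) * (cAx d N δK * (cAx d N δK * C)) * Zl (d + 1) (δK - R))
        ((Fintype.card (Fib d) : ℝ) * (cAx d N δK * (cAx d N δK * C)) * Zl (d + 1) (δK - R))
        ((Fintype.card (Fib d) : ℝ) * C * Zl (d + 1) (δK - R) * ((Fintype.card (Fib d) : ℝ) ^ 2 * (cN' d N δS * Cs) * Zl (d + 1) (δS - R / 2) ^ 2))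
        ((Fintype.card (Fib d) : ℝ) * C * Zl (d + 1) (δK - R) * ((Fintype.card (Fib d) : ℝ) ^ 2 * (cN' d N δS * Cs) * Zl (d + 1) (δS - R / 2) ^ 2))
        ((Fintype.card (Fib d) : ℝ) ^ 2 * Cw * Zl (d + 1) (δW - R) ^ 2)
        ((Fintype.card (Fib d) : ℝ) * (cAx d N δK * (cAx d N δK * cK)) * Zl (d + 1) (δK - R))
        ((Fintype.card (Fib d) : ℝ) * cK * Zl (d + 1) (δK - R) * ((Fintype.card (Fib d) : ℝ) ^ 2 * (cN' d N δS * Cs) * Zl (d + 1) (δS - R / 2) ^ 2) +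
          (Fintype.card (Fib d) : ℝ) * C * Zl (d + 1) (δK - R) * ((Fintype.card (Fib d) : ℝ) ^ 2 * (cN' d N δS * cS) * Zl (d + 1) (δS - R / 2) ^ 2))
        ((Fintype.card (Fib d) : ℝ) ^ 2 * cW * Zl (d + 1) (δW - R) ^ 2))
      (R * N) θ := by
  have hδK : 0 < δK := hR.trans hRK
  have hδS : 0 ≤ δS := by linarith
  have e : (fun k => hessKer (axDressK N (K k)) (axVertexOfK (K k) N (S k)) (W k)) =
      fun k => hessKer (axDressK N (K k)) (vertexOfK (K k) N (coProj N (S k))) (W k) :=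
    funext fun k => by rw [axVertexOfK_eq_vertexOfK_coProj hN hK hδK hS hδS k]
  have einf : axVertexOfK Kinf N Sinf = vertexOfK Kinf N (coProj N Sinf) :=
    funext fun μ => funext fun y => (vertexOfK_coProj_eq hN hKinf hδK hSinf hδS μ y).symm
  rw [e, einf]
  -- the A-slot `Π K Π`: uniform bound, the limit, and the deviations (the dressing is additive)
  have hA : ∀ k, ColW (axDressK N (K k)) R ((Fintype.card (Fib d) : ℝ) * (cAx d N δK * (cAx d N δK * C)) * Zl (d + 1) (δK - R)) :=
    fun k => colW_of_decays (decays_axDressK hN (hK k) hδK.le) hRK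
  have hAinf : ColW (axDressK N Kinf) R ((Fintype.card (Fib d) : ℝ) * (cAx d N δK * (cAx d N δK * C)) * Zl (d + 1) (δK - R)) :=
    colW_of_decays (decays_axDressK hN hKinf hδK.le) hRK
  have hArate : ∀ k, ColW (axDressK N (K k) - axDressK N Kinf) R
      ((Fintype.card (Fib d) : ℝ) * (cAx d N δK * (cAx d N δK * cK)) * Zl (d + 1) (δK - R) * θ ^ k) := fun k =>
    (colW_of_decays (decays_axDressK_sub hN (hKrate k) hδK.le) hRK).mono (le_of_eq (by ring))
  -- the V-slot: UNDRESSED `K`-columns against the `Πᵀ`-dressed stencils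
  have hKW : ∀ k, ColW (K k) R ((Fintype.card (Fib d) : ℝ) * C * Zl (d + 1) (δK - R)) := fun k => colW_of_decays (hK k) hRK
  have hKWinf : ColW Kinf R ((Fintype.card (Fib d) : ℝ) * C * Zl (d + 1) (δK - R)) := colW_of_decays hKinf hRK
  have hKWrate : ∀ k, ColW (K k - Kinf) R ((Fintype.card (Fib d) : ℝ) * cK * Zl (d + 1) (δK - R) * θ ^ k) := fun k =>
    (colW_of_decays (hKrate k) hRK).mono (le_of_eq (by ring))
  have hSW : ∀ k, LocStencilW (coProj N (S k)) (R / 2) ((Fintype.card (Fib d) : ℝ) ^ 2 * (cN' d N δS * Cs) * Zl (d + 1) (δS - R / 2) ^ 2) :=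
    fun k => locStencilW_of_locStencil (locStencil_coProj hN (hS k) hδS) hRS
  have hSWinf : LocStencilW (coProj N Sinf) (R / 2) ((Fintype.card (Fib d) : ℝ) ^ 2 * (cN' d N δS * Cs) * Zl (d + 1) (δS - R / 2) ^ 2) :=
    locStencilW_of_locStencil (locStencil_coProj hN hSinf hδS) hRS
  have hSWrate : ∀ k, LocStencilW (coProj N (S k) - coProj N Sinf) (R / 2)
      (((Fintype.card (Fib d) : ℝ) ^ 2 * (cN' d N δS * cS) * Zl (d + 1) (δS - R / 2) ^ 2) * θ ^ k) := fun k =>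
    (locStencilW_of_locStencil (locStencil_coProj_sub hN (hSrate k) hδS) hRS).mono (le_of_eq (by ring))
  have hV := fun k => vertexFamilyW_vertexOfK (hKW k) (hSW k) hR N
  have hVinf := vertexFamilyW_vertexOfK hKWinf hSWinf hR N
  have hVrate := fun k => vertexFamilyW_vertexOfK_rate (S := fun k => coProj N (S k)) (Sinf := coProj N Sinf) hKW hKWinf hKWrate hSW
    hSWinf hSWrate hR N k
  -- the W-slot
  have hWW : ∀ k, VertexFamily₂W (W k) N R ((Fintype.card (Fib d) : ℝ) ^ 2 * Cw * Zl (d + 1) (δW - R) ^ 2) :=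
    fun k => vertexFamily₂W_of_vertexFamily₂ (hW k) hRW
  have hWWinf : VertexFamily₂W Winf N R ((Fintype.card (Fib d) : ℝ) ^ 2 * Cw * Zl (d + 1) (δW - R) ^ 2) :=
    vertexFamily₂W_of_vertexFamily₂ hWinf hRW
  have hWWrate : ∀ k, VertexFamily₂W (W k - Winf) N R ((Fintype.card (Fib d) : ℝ) ^ 2 * cW * Zl (d + 1) (δW - R) ^ 2 * θ ^ k) :=
    fun k => (vertexFamily₂W_of_vertexFamily₂ (hWrate k) hRW).mono (le_of_eq (by ring))
  exact geometricRate_hessKer_halfV (V := fun k => vertexOfK (K k) N (coProj N (S k))) (Vinf := vertexOfK Kinf N (coProj N Sinf))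
    hA hAinf hArate hV hVinf hVrate hWW hWWinf hWWrate hR μ ν

/-- [folklore] **(SW1)-SHAPE END AGAINST NAMED LIMIT PRIMITIVES**: `GeomRate` of the dressed family's second moments TO
`secondMoment (hessKer (Π K∞ Π) (V^Π_{K∞} S∞) W∞) μ ν`, `c₀ = betaPrime510 (d+1) (lipW …) (R·N)` (the (UD) half is
`HessKerDressedCauchy.uniformDecay_hessKer_dress_of_pointwise`; `LimitRate.abs_secondMoment_sub_limit_le`).  NO range of `θ`. -/
theorem geomRate_secondMoment_hessKer_dress_of_pointwise_lim (hN : 1 ≤ N)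
    (hK : ∀ k, Decays (K k) C δK) (hKinf : Decays Kinf C δK) (hKrate : ∀ k, Decays (K k - Kinf) (cK * θ ^ k) δK)
    (hS : ∀ k, LocStencil (S k) Cs δS) (hSinf : LocStencil Sinf Cs δS) (hSrate : ∀ k, LocStencil (S k - Sinf) (cS * θ ^ k) δS)
    (hW : ∀ k, VertexFamily₂ (W k) N Cw δW) (hWinf : VertexFamily₂ Winf N Cw δW)
    (hWrate : ∀ k, VertexFamily₂ (W k - Winf) N (cW * θ ^ k) δW)
    (hR : 0 < R) (hRK : R < δK) (hRS : R / 2 < δS) (hRW : R < δW) (μ ν : Fin (d + 1)) :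
    GeomRate (fun k => B12Beta.secondMoment (hessKer (axDressK N (K k)) (axVertexOfK (K k) N (S k)) (W k)) μ ν)
      (B12Beta.secondMoment (hessKer (axDressK N Kinf) (axVertexOfK Kinf N Sinf) Winf) μ ν)
      (betaPrime510 (d + 1)
        (lipW ((Fintype.card (Fib d) : ℝ) * (cAx d N δK * (cAx d N δK * C)) * Zl (d + 1) (δK - R))
          ((Fintype.card (Fib d) : ℝ) * (cAx d N δK * (cAx d N δK * C)) * Zl (d + 1) (δK - R))
          ((Fintype.card (Fib d) : ℝ) * C * Zl (d + 1) (δK - R) * ((Fintype.card (Fib d) : ℝ) ^ 2 * (cN' d N δS * Cs) * Zl (d + 1) (δS - R / 2) ^ 2))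
          ((Fintype.card (Fib d) : ℝ) * C * Zl (d + 1) (δK - R) * ((Fintype.card (Fib d) : ℝ) ^ 2 * (cN' d N δS * Cs) * Zl (d + 1) (δS - R / 2) ^ 2))
          ((Fintype.card (Fib d) : ℝ) ^ 2 * Cw * Zl (d + 1) (δW - R) ^ 2)
          ((Fintype.card (Fib d) : ℝ) * (cAx d N δK * (cAx d N δK * cK)) * Zl (d + 1) (δK - R))
          ((Fintype.card (Fib d) : ℝ) * cK * Zl (d + 1) (δK - R) * ((Fintype.card (Fib d) : ℝ) ^ 2 * (cN' d N δS * Cs) * Zl (d + 1) (δS - R / 2) ^ 2) +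
            (Fintype.card (Fib d) : ℝ) * C * Zl (d + 1) (δK - R) * ((Fintype.card (Fib d) : ℝ) ^ 2 * (cN' d N δS * cS) * Zl (d + 1) (δS - R / 2) ^ 2))
          ((Fintype.card (Fib d) : ℝ) ^ 2 * cW * Zl (d + 1) (δW - R) ^ 2))
        (R * N)) θ := by
  have hRN : 0 < R * (N : ℝ) := mul_pos hR (by exact_mod_cast (show 0 < N by omega))
  exact fun k => LimitRate.abs_secondMoment_sub_limit_le (uniformDecay_hessKer_dress_of_pointwise hN hK hS hW hR hRK hRS hRW μ ν)
    (geometricRate_hessKer_dress_of_pointwise_lim hN hK hKinf hKrate hS hSinf hSrate hW hWinf hWrate hR hRK hRS hRW μ ν) hRN hRN k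

/-- [folklore] **THE TELESCOPED LIMIT KERNEL OF THE DRESSED FAMILY IS THE HESSIAN KERNEL OF THE DRESSED LIMIT PRIMITIVES**, entrywise
in the `(μ,ν)` component (`0 ≤ θ < 1`; `LimitRate.GeometricRate.limKernelOf_eq`, uniqueness of real limits). -/
theorem limKernelOf_hessKer_dress_apply (hN : 1 ≤ N)
    (hK : ∀ k, Decays (K k) C δK) (hKinf : Decays Kinf C δK) (hKrate : ∀ k, Decays (K k - Kinf) (cK * θ ^ k) δK)
    (hS : ∀ k, LocStencil (S k) Cs δS) (hSinf : LocStencil Sinf Cs δS) (hSrate : ∀ k, LocStencil (S k - Sinf) (cS * θ ^ k) δS)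
    (hW : ∀ k, VertexFamily₂ (W k) N Cw δW) (hWinf : VertexFamily₂ Winf N Cw δW)
    (hWrate : ∀ k, VertexFamily₂ (W k - Winf) N (cW * θ ^ k) δW)
    (hR : 0 < R) (hRK : R < δK) (hRS : R / 2 < δS) (hRW : R < δW) (hθ0 : 0 ≤ θ) (hθ1 : θ < 1) (μ ν : Fin (d + 1))
    (x : Fin (d + 1) → ℤ) :
    limKernelOf (fun k => hessKer (axDressK N (K k)) (axVertexOfK (K k) N (S k)) (W k)) μ ν x =
      hessKer (axDressK N Kinf) (axVertexOfK Kinf N Sinf) Winf μ ν x :=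
  (geometricRate_hessKer_dress_of_pointwise_lim hN hK hKinf hKrate hS hSinf hSrate hW hWinf hWrate hR hRK hRS hRW μ ν).limKernelOf_eq
    hθ0 hθ1 x

end DressedLim

/-! ## §3 Dimension four: THE WALL'S FAMILY `TbalOf Lc (JsBalOf …)` — the identification binder in explicit form -/

section WallLim

variable {Lc : ℕ} [NeZero Lc] (hLc : 1 ≤ Lc) (cE cVH cΛ : ℝ)
  (W : ℕ → Fin (3 + 1) → (Fin (3 + 1) → ℤ) → Fin (3 + 1) → (Fin (3 + 1) → ℤ) → MKer (3 + 1) (Fib 3))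
  (Cw' δw : ℕ → ℝ) (hδw : ∀ j, 0 < δw j) (hW' : ∀ j, VertexFamily₂ (W j) Lc (Cw' j) (δw j))
  {Kinf : MKer (3 + 1) (Fib 3)} {Sinf : Fin (3 + 1) → (Fin (3 + 1) → ℤ) → MKer (3 + 1) (Fib 3)}
  {Winf : Fin (3 + 1) → (Fin (3 + 1) → ℤ) → Fin (3 + 1) → (Fin (3 + 1) → ℤ) → MKer (3 + 1) (Fib 3)}
  {R C cK δK Cs cS δS Cw cW δW θ : ℝ}

/-- [folklore] **THE END INSTANCE OVER `JsBalOf` — LIMIT CURRENCY**: for an2's literal dressed family and ANY named limit primitives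
`(K∞, S∞, W∞)` with `j`-uniform bounds + rate data on the UNDRESSED primitives `KInvStep Lc j`, `(JsBal0Of … j).S`, `W j`:
`GeomRate (j ↦ secondMoment (TbalOf Lc (JsBalOf …) j) μ ν) (secondMoment (hessKer (axDressK Lc K∞) (axVertexOfK K∞ Lc S∞) W∞) μ ν) c₀ θ` with
`c₀ = betaPrime510 4 (lipW …) (R·Lc)` EXPLICIT (an2's `TbalOf_JsBalOf` BY NAME).  NO range of `θ`; every binder a hypothesis shape. -/
theorem geomRate_secondMoment_TbalOf_JsBalOf_lim
    (hK : ∀ j, Decays (KInvStep (d := 3) Lc j) C δK) (hKinf : Decays Kinf C δK)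
    (hKrate : ∀ j, Decays (KInvStep (d := 3) Lc j - Kinf) (cK * θ ^ j) δK)
    (hS : ∀ j, LocStencil (JsBal0Of hLc cE cVH cΛ W Cw' δw hδw hW' j).S Cs δS) (hSinf : LocStencil Sinf Cs δS)
    (hSrate : ∀ j, LocStencil ((JsBal0Of hLc cE cVH cΛ W Cw' δw hδw hW' j).S - Sinf) (cS * θ ^ j) δS)
    (hW : ∀ j, VertexFamily₂ (W j) Lc Cw δW) (hWinf : VertexFamily₂ Winf Lc Cw δW)
    (hWrate : ∀ j, VertexFamily₂ (W j - Winf) Lc (cW * θ ^ j) δW)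
    (hR : 0 < R) (hRK : R < δK) (hRS : R / 2 < δS) (hRW : R < δW) (μ ν : Fin 4) :
    GeomRate (fun j => B12Beta.secondMoment (TbalOf Lc (JsBalOf hLc cE cVH cΛ W Cw' δw hδw hW') j) μ ν)
      (B12Beta.secondMoment (hessKer (axDressK Lc Kinf) (axVertexOfK Kinf Lc Sinf) Winf) μ ν)
      (betaPrime510 4
        (lipW ((Fintype.card (Fib 3) : ℝ) * (cAx 3 Lc δK * (cAx 3 Lc δK * C)) * Zl 4 (δK - R))
          ((Fintype.card (Fib 3) : ℝ) * (cAx 3 Lc δK * (cAx 3 Lc δK * C)) * Zl 4 (δK - R))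
          ((Fintype.card (Fib 3) : ℝ) * C * Zl 4 (δK - R) * ((Fintype.card (Fib 3) : ℝ) ^ 2 * (cN' 3 Lc δS * Cs) * Zl 4 (δS - R / 2) ^ 2))
          ((Fintype.card (Fib 3) : ℝ) * C * Zl 4 (δK - R) * ((Fintype.card (Fib 3) : ℝ) ^ 2 * (cN' 3 Lc δS * Cs) * Zl 4 (δS - R / 2) ^ 2))
          ((Fintype.card (Fib 3) : ℝ) ^ 2 * Cw * Zl 4 (δW - R) ^ 2)
          ((Fintype.card (Fib 3) : ℝ) * (cAx 3 Lc δK * (cAx 3 Lc δK * cK)) * Zl 4 (δK - R))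
          ((Fintype.card (Fib 3) : ℝ) * cK * Zl 4 (δK - R) * ((Fintype.card (Fib 3) : ℝ) ^ 2 * (cN' 3 Lc δS * Cs) * Zl 4 (δS - R / 2) ^ 2) +
            (Fintype.card (Fib 3) : ℝ) * C * Zl 4 (δK - R) * ((Fintype.card (Fib 3) : ℝ) ^ 2 * (cN' 3 Lc δS * cS) * Zl 4 (δS - R / 2) ^ 2))
          ((Fintype.card (Fib 3) : ℝ) ^ 2 * cW * Zl 4 (δW - R) ^ 2))
        (R * Lc)) θ := by
  have e : TbalOf Lc (JsBalOf hLc cE cVH cΛ W Cw' δw hδw hW') =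
      fun j => hessKer (axDressK Lc (KInvStep (d := 3) Lc j))
        (axVertexOfK (KInvStep (d := 3) Lc j) Lc (JsBal0Of hLc cE cVH cΛ W Cw' δw hδw hW' j).S) (W j) :=
    funext fun j => TbalOf_JsBalOf hLc cE cVH cΛ W Cw' δw hδw hW' j
  rw [e]
  exact geomRate_secondMoment_hessKer_dress_of_pointwise_lim (S := fun j => (JsBal0Of hLc cE cVH cΛ W Cw' δw hδw hW' j).S) (W := W)
    one_le_Lc hK hKinf hKrate hS hSinf hSrate hW hWinf hWrate hR hRK hRS hRW μ ν

/-- [folklore] **THE WALL ⟺ THE EXPLICIT IDENTIFICATION, LIMIT CURRENCY**: under `j`-uniform bounds + rate data to ANY named limit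
primitives `(K∞, S∞, W∞)` and `0 ≤ θ < 1`, THE WALL'S LITERAL TERM `OneStepKernelFamily.D1Drift Lc (JsBalOf …) N μ ν` holds IFF
`secondMoment (hessKer (axDressK Lc K∞) (axVertexOfK K∞ Lc S∞) W∞) μ ν = B12Normalization.stepBal N Lc`
(`HessKerDressedCauchy.d1Drift_iff_lim_eq` + asym2's `allScalesSeq_of_geomRate` + uniqueness of the limit value).  Discharges NOTHING. -/
theorem d1Drift_JsBalOf_iff_of_lim
    (hK : ∀ j, Decays (KInvStep (d := 3) Lc j) C δK) (hKinf : Decays Kinf C δK)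
    (hKrate : ∀ j, Decays (KInvStep (d := 3) Lc j - Kinf) (cK * θ ^ j) δK)
    (hS : ∀ j, LocStencil (JsBal0Of hLc cE cVH cΛ W Cw' δw hδw hW' j).S Cs δS) (hSinf : LocStencil Sinf Cs δS)
    (hSrate : ∀ j, LocStencil ((JsBal0Of hLc cE cVH cΛ W Cw' δw hδw hW' j).S - Sinf) (cS * θ ^ j) δS)
    (hW : ∀ j, VertexFamily₂ (W j) Lc Cw δW) (hWinf : VertexFamily₂ Winf Lc Cw δW)
    (hWrate : ∀ j, VertexFamily₂ (W j - Winf) Lc (cW * θ ^ j) δW)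
    (hR : 0 < R) (hRK : R < δK) (hRS : R / 2 < δS) (hRW : R < δW) (hθ0 : 0 ≤ θ) (hθ1 : θ < 1) (μ ν : Fin 4) (N : ℝ) :
    D1Drift Lc (JsBalOf hLc cE cVH cΛ W Cw' δw hδw hW') N μ ν ↔
      B12Beta.secondMoment (hessKer (axDressK Lc Kinf) (axVertexOfK Kinf Lc Sinf) Winf) μ ν = B12Normalization.stepBal N Lc := by
  have hG := geomRate_secondMoment_TbalOf_JsBalOf_lim hLc cE cVH cΛ W Cw' δw hδw hW' hK hKinf hKrate hS hSinf hSrate hW hWinf hWrate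
    hR hRK hRS hRW μ ν
  have hall := allScalesSeq_of_geomRate hG hθ0 hθ1.le
  have hlim : CauchyRate.lim (fun j => B12Beta.secondMoment (TbalOf Lc (JsBalOf hLc cE cVH cΛ W Cw' δw hδw hW') j) μ ν) =
      B12Beta.secondMoment (hessKer (axDressK Lc Kinf) (axVertexOfK Kinf Lc Sinf) Winf) μ ν :=
    (hall.cauchyRate.eq_lim hθ1 (hG.tendsto hθ0 hθ1)).symm
  rw [d1Drift_iff_lim_eq (JsBalOf hLc cE cVH cΛ W Cw' δw hδw hW') hall hθ0 hθ1 N, hlim]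

/-- [folklore] **THE WALL FROM RATE DATA + THE EXPLICIT IDENTIFICATION** at named limit primitives (the (⇐) direction). -/
theorem d1Drift_JsBalOf_of_lim_eq
    (hK : ∀ j, Decays (KInvStep (d := 3) Lc j) C δK) (hKinf : Decays Kinf C δK)
    (hKrate : ∀ j, Decays (KInvStep (d := 3) Lc j - Kinf) (cK * θ ^ j) δK)
    (hS : ∀ j, LocStencil (JsBal0Of hLc cE cVH cΛ W Cw' δw hδw hW' j).S Cs δS) (hSinf : LocStencil Sinf Cs δS)
    (hSrate : ∀ j, LocStencil ((JsBal0Of hLc cE cVH cΛ W Cw' δw hδw hW' j).S - Sinf) (cS * θ ^ j) δS)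
    (hW : ∀ j, VertexFamily₂ (W j) Lc Cw δW) (hWinf : VertexFamily₂ Winf Lc Cw δW)
    (hWrate : ∀ j, VertexFamily₂ (W j - Winf) Lc (cW * θ ^ j) δW)
    (hR : 0 < R) (hRK : R < δK) (hRS : R / 2 < δS) (hRW : R < δW) (hθ0 : 0 ≤ θ) (hθ1 : θ < 1) (μ ν : Fin 4) {N : ℝ}
    (hident : B12Beta.secondMoment (hessKer (axDressK Lc Kinf) (axVertexOfK Kinf Lc Sinf) Winf) μ ν = B12Normalization.stepBal N Lc) :
    D1Drift Lc (JsBalOf hLc cE cVH cΛ W Cw' δw hδw hW') N μ ν :=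
  (d1Drift_JsBalOf_iff_of_lim hLc cE cVH cΛ W Cw' δw hδw hW' hK hKinf hKrate hS hSinf hSrate hW hWinf hWrate hR hRK hRS hRW hθ0 hθ1
    μ ν N).2 hident

end WallLim

section WallCauchy

variable {Lc : ℕ} [NeZero Lc] (hLc : 1 ≤ Lc) (cE cVH cΛ : ℝ)
  (W : ℕ → Fin (3 + 1) → (Fin (3 + 1) → ℤ) → Fin (3 + 1) → (Fin (3 + 1) → ℤ) → MKer (3 + 1) (Fib 3))
  (Cw' δw : ℕ → ℝ) (hδw : ∀ j, 0 < δw j) (hW' : ∀ j, VertexFamily₂ (W j) Lc (Cw' j) (δw j))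
  {R C cK δK Cs cS δS Cw cW δW θ : ℝ}

/-- [folklore] **THE TELESCOPED LIMIT KERNEL OF THE WALL'S FAMILY, EXPLICITLY** (road A2's `b_∞` object): under EXACTLY the six
(CONV-C-Cauchy) binders of `HessKerDressedCauchy` §4 and `0 ≤ θ < 1`, entrywise in the `(μ,ν)` component,
`limKernelOf (TbalOf Lc (JsBalOf …)) μ ν x = hessKer (axDressK Lc K∞) (axVertexOfK K∞ Lc S∞) W∞ μ ν x` at the CONSTRUCTED limits
`K∞ = limMKerOf (KInvStep Lc)`, `S∞ = limStOf (j ↦ (JsBal0Of … j).S)`, `W∞ = limTabOf W` (§1 closure lemmas feed §2). -/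
theorem limKernelOf_TbalOf_JsBalOf_apply
    (hK : ∀ j, Decays (KInvStep (d := 3) Lc j) C δK)
    (hKall : ∀ k j, Decays (KInvStep (d := 3) Lc (k + j) - KInvStep (d := 3) Lc k) (cK * θ ^ k) δK)
    (hS : ∀ j, LocStencil (JsBal0Of hLc cE cVH cΛ W Cw' δw hδw hW' j).S Cs δS)
    (hSall : ∀ k j, LocStencil ((JsBal0Of hLc cE cVH cΛ W Cw' δw hδw hW' (k + j)).S - (JsBal0Of hLc cE cVH cΛ W Cw' δw hδw hW' k).S) (cS * θ ^ k) δS)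
    (hW : ∀ j, VertexFamily₂ (W j) Lc Cw δW) (hWall : ∀ k j, VertexFamily₂ (W (k + j) - W k) Lc (cW * θ ^ k) δW)
    (hR : 0 < R) (hRK : R < δK) (hRS : R / 2 < δS) (hRW : R < δW) (hθ0 : 0 ≤ θ) (hθ1 : θ < 1) (μ ν : Fin 4) (x : Fin 4 → ℤ) :
    limKernelOf (TbalOf Lc (JsBalOf hLc cE cVH cΛ W Cw' δw hδw hW')) μ ν x =
      hessKer (axDressK Lc (limMKerOf (KInvStep (d := 3) Lc)))
        (axVertexOfK (limMKerOf (KInvStep (d := 3) Lc)) Lc (limStOf fun j => (JsBal0Of hLc cE cVH cΛ W Cw' δw hδw hW' j).S))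
        (limTabOf W) μ ν x := by
  have e : TbalOf Lc (JsBalOf hLc cE cVH cΛ W Cw' δw hδw hW') =
      fun j => hessKer (axDressK Lc (KInvStep (d := 3) Lc j))
        (axVertexOfK (KInvStep (d := 3) Lc j) Lc (JsBal0Of hLc cE cVH cΛ W Cw' δw hδw hW' j).S) (W j) :=
    funext fun j => TbalOf_JsBalOf hLc cE cVH cΛ W Cw' δw hδw hW' j
  rw [e]
  exact limKernelOf_hessKer_dress_apply (S := fun j => (JsBal0Of hLc cE cVH cΛ W Cw' δw hδw hW' j).S) (W := W)
    (Kinf := limMKerOf (KInvStep (d := 3) Lc)) (Sinf := limStOf fun j => (JsBal0Of hLc cE cVH cΛ W Cw' δw hδw hW' j).S)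
    (Winf := limTabOf W) one_le_Lc hK (decays_limMKerOf hK hKall hθ1) (decays_sub_limMKerOf hKall hθ1) hS
    (locStencil_limStOf hS hSall hθ1) (locStencil_sub_limStOf hSall hθ1) hW (vertexFamily₂_limTabOf hW hWall hθ1)
    (vertexFamily₂_sub_limTabOf hWall hθ1) hR hRK hRS hRW hθ0 hθ1 μ ν x

/-- [folklore] **THE LEAD's `hident` LEFT-HAND SIDE, EXPLICITLY**: under the six (CONV-C-Cauchy) binders and `0 ≤ θ < 1`,
`secondMoment (limKernelOf (TbalOf Lc (JsBalOf …))) μ ν = secondMoment (hessKer (axDressK Lc K∞) (axVertexOfK K∞ Lc S∞) W∞) μ ν` at the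
constructed limits — so road A2's identification binder and the explicit identity of `d1Drift_JsBalOf_iff_of_cauchy` are ONE statement. -/
theorem secondMoment_limKernelOf_TbalOf_JsBalOf
    (hK : ∀ j, Decays (KInvStep (d := 3) Lc j) C δK)
    (hKall : ∀ k j, Decays (KInvStep (d := 3) Lc (k + j) - KInvStep (d := 3) Lc k) (cK * θ ^ k) δK)
    (hS : ∀ j, LocStencil (JsBal0Of hLc cE cVH cΛ W Cw' δw hδw hW' j).S Cs δS)
    (hSall : ∀ k j, LocStencil ((JsBal0Of hLc cE cVH cΛ W Cw' δw hδw hW' (k + j)).S - (JsBal0Of hLc cE cVH cΛ W Cw' δw hδw hW' k).S) (cS * θ ^ k) δS)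
    (hW : ∀ j, VertexFamily₂ (W j) Lc Cw δW) (hWall : ∀ k j, VertexFamily₂ (W (k + j) - W k) Lc (cW * θ ^ k) δW)
    (hR : 0 < R) (hRK : R < δK) (hRS : R / 2 < δS) (hRW : R < δW) (hθ0 : 0 ≤ θ) (hθ1 : θ < 1) (μ ν : Fin 4) :
    B12Beta.secondMoment (limKernelOf (TbalOf Lc (JsBalOf hLc cE cVH cΛ W Cw' δw hδw hW'))) μ ν =
      B12Beta.secondMoment (hessKer (axDressK Lc (limMKerOf (KInvStep (d := 3) Lc)))
        (axVertexOfK (limMKerOf (KInvStep (d := 3) Lc)) Lc (limStOf fun j => (JsBal0Of hLc cE cVH cΛ W Cw' δw hδw hW' j).S))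
        (limTabOf W)) μ ν :=
  secondMoment_congr fun x => limKernelOf_TbalOf_JsBalOf_apply hLc cE cVH cΛ W Cw' δw hδw hW' hK hKall hS hSall hW hWall hR hRK hRS
    hRW hθ0 hθ1 μ ν x

/-- [folklore] **THE WALL ⟺ THE EXPLICIT IDENTIFICATION AT THE CONSTRUCTED LIMITS, CAUCHY CURRENCY** — EXACTLY the six (CONV-C-Cauchy)
binders of `HessKerDressedCauchy.d1Drift_JsBalOf_iff_lim_eq` (nothing added) and `0 ≤ θ < 1`:
`D1Drift Lc (JsBalOf …) N μ ν ↔ secondMoment (hessKer (axDressK Lc K∞) (axVertexOfK K∞ Lc S∞) W∞) μ ν = stepBal N Lc`,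
`K∞ = limMKerOf (KInvStep Lc)`, `S∞ = limStOf (j ↦ (JsBal0Of … j).S)`, `W∞ = limTabOf W`.  Road A2's second half, in explicit form; NOT
proved here. -/
theorem d1Drift_JsBalOf_iff_of_cauchy
    (hK : ∀ j, Decays (KInvStep (d := 3) Lc j) C δK)
    (hKall : ∀ k j, Decays (KInvStep (d := 3) Lc (k + j) - KInvStep (d := 3) Lc k) (cK * θ ^ k) δK)
    (hS : ∀ j, LocStencil (JsBal0Of hLc cE cVH cΛ W Cw' δw hδw hW' j).S Cs δS)
    (hSall : ∀ k j, LocStencil ((JsBal0Of hLc cE cVH cΛ W Cw' δw hδw hW' (k + j)).S - (JsBal0Of hLc cE cVH cΛ W Cw' δw hδw hW' k).S) (cS * θ ^ k) δS)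
    (hW : ∀ j, VertexFamily₂ (W j) Lc Cw δW) (hWall : ∀ k j, VertexFamily₂ (W (k + j) - W k) Lc (cW * θ ^ k) δW)
    (hR : 0 < R) (hRK : R < δK) (hRS : R / 2 < δS) (hRW : R < δW) (hθ0 : 0 ≤ θ) (hθ1 : θ < 1) (μ ν : Fin 4) (N : ℝ) :
    D1Drift Lc (JsBalOf hLc cE cVH cΛ W Cw' δw hδw hW') N μ ν ↔
      B12Beta.secondMoment (hessKer (axDressK Lc (limMKerOf (KInvStep (d := 3) Lc)))
        (axVertexOfK (limMKerOf (KInvStep (d := 3) Lc)) Lc (limStOf fun j => (JsBal0Of hLc cE cVH cΛ W Cw' δw hδw hW' j).S))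
        (limTabOf W)) μ ν = B12Normalization.stepBal N Lc :=
  d1Drift_JsBalOf_iff_of_lim hLc cE cVH cΛ W Cw' δw hδw hW' (Kinf := limMKerOf (KInvStep (d := 3) Lc))
    (Sinf := limStOf fun j => (JsBal0Of hLc cE cVH cΛ W Cw' δw hδw hW' j).S) (Winf := limTabOf W) hK
    (decays_limMKerOf hK hKall hθ1) (decays_sub_limMKerOf hKall hθ1) hS (locStencil_limStOf hS hSall hθ1)
    (locStencil_sub_limStOf hSall hθ1) hW (vertexFamily₂_limTabOf hW hWall hθ1) (vertexFamily₂_sub_limTabOf hWall hθ1) hR hRK hRS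
    hRW hθ0 hθ1 μ ν N

/-- [folklore] **THE WALL FROM (CONV-C-Cauchy) + THE EXPLICIT IDENTIFICATION AT THE CONSTRUCTED LIMITS** (the (⇐) direction; the twin of
`HessKerDressedCauchy.d1Drift_JsBalOf_of_limKernel_eq` with `hident` read explicitly). -/
theorem d1Drift_JsBalOf_of_cauchy_eq
    (hK : ∀ j, Decays (KInvStep (d := 3) Lc j) C δK)
    (hKall : ∀ k j, Decays (KInvStep (d := 3) Lc (k + j) - KInvStep (d := 3) Lc k) (cK * θ ^ k) δK)
    (hS : ∀ j, LocStencil (JsBal0Of hLc cE cVH cΛ W Cw' δw hδw hW' j).S Cs δS)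
    (hSall : ∀ k j, LocStencil ((JsBal0Of hLc cE cVH cΛ W Cw' δw hδw hW' (k + j)).S - (JsBal0Of hLc cE cVH cΛ W Cw' δw hδw hW' k).S) (cS * θ ^ k) δS)
    (hW : ∀ j, VertexFamily₂ (W j) Lc Cw δW) (hWall : ∀ k j, VertexFamily₂ (W (k + j) - W k) Lc (cW * θ ^ k) δW)
    (hR : 0 < R) (hRK : R < δK) (hRS : R / 2 < δS) (hRW : R < δW) (hθ0 : 0 ≤ θ) (hθ1 : θ < 1) (μ ν : Fin 4) {N : ℝ}
    (hident : B12Beta.secondMoment (hessKer (axDressK Lc (limMKerOf (KInvStep (d := 3) Lc)))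
        (axVertexOfK (limMKerOf (KInvStep (d := 3) Lc)) Lc (limStOf fun j => (JsBal0Of hLc cE cVH cΛ W Cw' δw hδw hW' j).S))
        (limTabOf W)) μ ν = B12Normalization.stepBal N Lc) :
    D1Drift Lc (JsBalOf hLc cE cVH cΛ W Cw' δw hδw hW') N μ ν :=
  (d1Drift_JsBalOf_iff_of_cauchy hLc cE cVH cΛ W Cw' δw hδw hW' hK hKall hS hSall hW hWall hR hRK hRS hRW hθ0 hθ1 μ ν N).2 hident

end WallCauchy

end Literature.MathematicalPhysics.QuantumFieldTheory.Balaban1983to89.Beta.HessKerDressedLimit
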